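import Summits.SmoothPoincare4.SmoothPoincare4.Theses.LensThinSweepouts
import Literature.Topology.FourManifolds.Handles
import Literature.Topology.FourManifolds.Gluing
import HarnessLib

/-!
# Line `birth` — BC3 skeleton for the crux `LensThinSweepouts.WidthTwoExists` (stmt-SmoothPoincare4-7583)

Route `route-SmoothPoincare4-LensThinSweepouts` (rank-4 crux E2), decl
`Summit.SmoothPoincare4.SmoothPoincare4.Theses.LensThinSweepouts.WidthTwoExists`:

  every homotopy 4-sphere `Σ` (`HomotopySphere 4`) carries a Morse function `f : Σ → ℝ`,
  injective on its critical set, each of whose regular levels `f⁻¹(t)` (a closed 3-manifold,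
  `RegularLevel h`) carries a Morse function with at most `2` critical points of index `1`
  — "level-genus width `w(Σ) ≤ 2`".

Standing of the crux (item notes, 2026-08-15): OPEN, SPC4-hard with zero slack (`SPC4 ⇒ E2` by
transporting the height function of `S⁴`, width `0`; given the sibling crux R2 it is `⇔ SPC4`).
No `Disproof.lean`, no `Lines/*`, no landed `Theorems/WidthTwoExists/Negative/*` for this crux
(`ledger crux ls stmt-SmoothPoincare4-7583`: no workfiles, 2026-08-17).

## The line: THIN MAZUR-TYPE SPLITTINGS ("a width-2 sweepout with six critical points")

The one place where width-`≤ 2` sweepouts are known to exist in bulk is the route header's own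
observation (NUMBERS / WHY IT MIGHT FAIL of R2): a twisted double `C ∪_φ C'` of MAZUR-TYPE pieces —
compact 4-manifolds with boundary built from one `0`-handle, one `1`-handle and one `2`-handle
(`HasHandleDecomposition 3 C (fun k => if k ≤ 2 then 1 else 0)`, the hypothesis of the tree's named
fact `Mazur1961_double_sphere_four`) — glued by a diffeomorphism `φ : ∂C ≅ ∂C'` of boundaries of
Heegaard genus `≤ 2` has the six-critical-point sweepout

  `∅ → S³ → S¹×S² → ∂C ≅ ∂C' → S¹×S² → S³ → ∅`   (indices `0,1,2 | 2,3,4`),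

all of whose levels have Heegaard genus `≤ max(1, g(∂C)) ≤ 2` (Akbulut–Kirby, *Mazur manifolds*,
Michigan Math. J. 26 (1979), doi:10.1307/mmj/1029002261: `∂W = Σ(2,5,7)` etc., Brieskorn spheres
of Heegaard genus `2`; Mazur 1961; Gompf–Stipsicz 1999 §4.6, §5.1). The line bets that this is the
general case: E2 ⇐ (S1) every homotopy 4-sphere IS such a thin Mazur-type union ∧ (S2, S3) the
Morse theory that turns the union into a sweepout. S1 is a RIGID normal form (lens `strengthen`):
it replaces "some sweepout, arbitrarily long, all levels thin" by "a (1,1,2,1,1)-handle structure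
with thin middle level", i.e. by a statement about ONE closed 3-manifold `∂C` and two framed knots,
where 3-manifold topology (genus-2 Heegaard theory, Dehn surgery on knots in `S¹×S²`) can bite.

* `stub_thinMazurSplitting` — **OPEN, the hard stub (crux-hard):** for every homotopy 4-sphere `S`
  there are compact smooth 4-manifolds with boundary `C`, `C'` (Hausdorff, second countable, model
  `𝓡∂ 4`), each with a handle decomposition with exactly one handle of each index `0, 1, 2` and
  none of index `≥ 3`, boundary data `bC`, `bC'`, a diffeomorphism `φ : ∂C ≅ ∂C'`, such that `∂C`
  carries a Morse function with `≤ 2` critical points of index `1` (Heegaard genus `≤ 2`, the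
  crux's own encoding) and `S.carrier = C ∪_φ C'` (`IsBoundaryGluing bC bC' φ (𝓡 4) S.carrier`).
  Contractibility of the pieces is NOT demanded (it is not needed downstream and is not automatic:
  `S⁴` has (1,1,2,1,1)-handle structures whose `0 ∪ 1 ∪ 2` piece has `π₁ = ℤ/2`, by sliding the
  two 2-handles of the trivial structure to attaching words `x⁻²`, `x³`). Logical status:
  `SPC4 ⇒ S1` (every `Σ ≅ S⁴ = D(W)` for a Mazur manifold `W` with `∂W = Σ(2,5,7)` of genus `2`,
  Mazur 1961 / `Mazur1961_double_sphere_four`; or `S⁴ = B⁴ ∪ B⁴` with a cancelling `1/2`-pair born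
  in each ball, `∂ = S³`); `S1 ⇒ E2` (this file); `S1 ⇒ SPC4` is NOT known (twisted doubles
  `C ∪_φ C̄` of Mazur corks with genus-2 boundary, cork twists of `S⁴` along Mazur corks, are
  homotopy spheres of exactly this shape whose standardness is open in general — Akbulut–Kirby 1979,
  Akbulut 1991, Gompf–Stipsicz 1999 §9.3). Why it might fail: an exotic `Σ` all of whose
  (1,1,2,1,1)-handle structures (if any: Kirby Problem 4.18 — 1-handles may be necessary; here
  exactly one per side is allowed) have middle level of Heegaard genus `≥ 3`; e.g. an exotic `Σ`
  whose every cork presentation from `S⁴` (Curtis–Freedman–Hsiang–Stong / Matveyev 1996, tree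
  `HomotopySphere.exists_corkPresentation_of_facts`) needs a cork with `≥ 2` one-handles or a
  boundary of genus `≥ 3`. Sources: doi:10.1307/mmj/1029002261 (AkbulutKirby1979), Mazur1961,
  Matveyev1996, CurtisFreedmanHsiangStong1996, GompfStipsicz1999 §5.1/§9.3, Kirby1997 (Problem 4.18).
  Size: open problem.
* `stub_mazurHalfSweepout` — **KNOWN Morse theory, size L:** a compact 4-manifold with boundary `C`
  with a handle decomposition of type (one `0`-, one `1`-, one `2`-handle) carries a Morse function
  `f` ADAPTED to `∂C` (`f ≡ 1` and regular on `∂C`, `f < 1` inside), injective on its critical set,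
  each of whose regular levels (interior levels, `IsRegularLevel (𝓡∂ 4) f t`) EITHER carries a Morse
  function with `≤ 1` critical point of index `1` OR is diffeomorphic to the boundary `bC.carrier`.
  Proof in print: rearrange the three critical values into index order `c₀ < c₁ < c₂ < 1` (Smale;
  Milnor 1965 Thm. 4.8 — tree `MorseRearrangement*.lean`, `NiceMorseFunctions.lean`); the levels are
  `∅` (`t < c₀`), `S³ = ∂B⁴` (`c₀ < t < c₁`, Morse lemma / disc theorem), `∂(B⁴ ∪ h¹) = S¹×S²` or
  `S¹×~S²` (`c₁ < t < c₂`, tree `OneHandlebodyClassification.lean`; both carry a Morse function with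
  one critical point of each index `0,1,2,3`), and `≅ f⁻¹(1) = ∂C` for `c₂ < t < 1` (no critical
  point in `f⁻¹[t,1]`: regular interval theorem, Milnor 1963 Thm. 3.1 — tree
  `RegularIntervalLevels.lean`, `RegularLevelCollar.lean`). Why it might fail: it does not
  mathematically; Lean risks are the `ncard`/orientation bookkeeping of the `S¹×~S²` case.
  Sources: Milnor1963 Thms. 3.1–3.2, MilnorHCobordism1965 Thm. 4.8, Kosinski1993 VII §2,
  GompfStipsicz1999 §4.2.
* `stub_glueHalfSweepouts` — **KNOWN Morse theory, size L/XL (the gluing lemma for level-genus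
  width):** if `C`, `C'` are compact 4-manifolds with boundary carrying adapted Morse functions
  `f`, `f'`, injective on their critical sets, all of whose regular levels either carry a Morse
  function with `≤ k` index-1 critical points or are diffeomorphic to the respective boundary, if
  `∂C` carries a Morse function with `≤ k` index-1 critical points, and `P = C ∪_φ C'` for a
  diffeomorphism `φ : ∂C ≅ ∂C'`, then `P` carries a Morse function, injective on its critical set,
  all of whose regular levels carry a Morse function with `≤ k` index-1 critical points — i.e.
  `w(C ∪_φ C') ≤ max(w(C, ∂C), w(C', ∂C'), g(∂C))`. Proof in print: normalise `f`, `f'` in collars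
  of the boundaries to `1 - s` (`s` the collar coordinate; no critical points near `∂`, compactness),
  identify a tubular neighbourhood of the seam `Y = ∂C ≡_φ ∂C'` in `P` with the two collars
  (uniqueness of gluing / of collars, Hirsch 1976 Thm. 8.2.1, tree `nonempty_diffeomorph_of_isBoundaryGluing`),
  and set `F = f` on `C`, `F = 2 - f'` on `C'`: `F` is Morse, its critical values are those of `f`
  (`< 1`) and `2 -` those of `f'` (`> 1`), its regular levels are regular levels of `f`, of `f'`,
  collar levels `≅ ∂C ≅_φ ∂C'`, or the seam `F⁻¹(1) = Y ≅ ∂C`; Morse functions and index counts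
  transport along diffeomorphisms. Why it might fail: it does not mathematically; the Lean cost is
  the seam smoothing inside an ARBITRARY `IsBoundaryGluing` witness `P` (go through the tree's
  gluing-uniqueness fact) and the transport of `IsMorse`/`morseIndex` along diffeomorphisms.
  Sources: Milnor1963 §3, HirschDT1976 §8.2 (Thm. 8.2.1), BrockerJanich1982 §13, MilnorHCobordism1965 §1 (Thm. 1.4).
* `widthTwoExists_of_stubs : <stub₁-sig> → <stub₂-sig> → <stub₃-sig> → <crux statement>` — the REAL
  composition (sorry-free): split `S` by stub 1, sweep each piece by stub 2 (`≤ 1 ≤ 2` index-1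
  points or parallel to the boundary), glue by stub 3 with `k = 2`.
* `WidthTwoExists_of : WidthTwoExists` — THE skeleton theorem: the crux BY NAME from the three
  declared stubs (the only `sorry`s of the file); the arrow form with the crux by name is the
  closing `example`.

`lean check --json` (farm, 2026-08-17): rc 0, errors 0, sorries 3 = the three `stub_*` (declaration
lines of `stub_thinMazurSplitting`, `stub_mazurHalfSweepout`, `stub_glueHalfSweepouts`), zero
elsewhere; `widthTwoExists_of_stubs` axioms {propext, Classical.choice, Quot.sound}; H21 audit:
`WidthTwoExists_of` = proof-of-item for `LensThinSweepouts.WidthTwoExists` (not closed: `sorryAx`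
through the stubs, as intended).

BC3 probes (planner folder `bc/probe_s{1,2,3}_{crux,summit}.lean` + `probe_s3_aesop_nosimp.lean`,
2026-08-17; imports = route file + `Handles` + `Gluing` only; `set_option maxHeartbeats 400000`;
tactic `first | exact? | simpa using hstub | simpa [WidthTwoExists] using hstub | aesop`, and for
stub 3 additionally one `example` per tactic and `aesop (config := { enableSimp := false })`):
ALL SIX FAIL, rc 1 each — stub 1 → `WidthTwoExists`: unsolved `⊢ WidthTwoExists` ("aesop: failed to
prove the goal after exhaustive search"); stub 1 → `SmoothPoincare4`: unsolved `⊢ SmoothPoincare4`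
(same); stub 2 → crux / summit: "aesop failed, made no progress" after `exact?`/`simpa` failed;
stub 3 → crux / summit: "`exact?` could not close the goal", `simpa`: type mismatch, `aesop`:
normalisation `simp` hits the heartbeat cap and, with normalisation off, "made no progress". Also
`⊢ WidthTwoExists` with NO hypothesis fails `exact? | aesop` in this import cone (dedup sanity).
No stub is cheaply the crux or the summit: stub 1 never mentions a Morse function on `Σ` (it is a
splitting statement), stubs 2–3 are conditional statements about GIVEN pieces with boundary.
Disproof used: none exists for this crux. Negatives index (SmoothPoincare4): 0 refuted statements
(`ledger negatives`, 2026-08-17). Barriers: `LowGenusTrisectionBarrier`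
(Meier–Schirmer–Zupan: genus-`≤ 2` trisections are standard) does not cover S1 — a
(1,1,2,1,1)-handle structure with genus-2 middle level has trisection genus bounded only by the
Heegaard genus of a surface in `S¹×S²` carrying BOTH attaching knots with their framings, unbounded
in general; `PropertyTwoRBarrier` concerns 1-handle-free structures (`k₁ = 0`), ours has `k₁ = 1`.
-/

noncomputable section

open scoped Manifold ContDiff Topology
open Literature.Topology.FourManifolds
open Summit.SmoothPoincare4.SmoothPoincare4.Theses.LensThinSweepouts (WidthTwoExists)

-- `Summit.<Summit>.<Problem>`: for the single-conjunct summit the duplicate segment is mandated.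
set_option linter.dupNamespace false
set_option linter.unusedVariables false

namespace Summit.SmoothPoincare4.SmoothPoincare4.Cruxes.WidthTwoExists.Birth

/-! ## The three registered stubs (`sorry` lives ONLY here; signatures over tree declarations) -/

/-- **Stub 1 (OPEN — the hard stub): every homotopy 4-sphere is a THIN MAZUR-TYPE UNION.**
For every homotopy 4-sphere `S` there are compact smooth 4-manifolds with boundary `C`, `C'`
(Hausdorff, second countable, model `𝓡∂ 4`), boundary data `bC`, `bC'` (model `𝓡 3`) and a
diffeomorphism `φ : ∂C ≅ ∂C'` with: `C` and `C'` each have a handle decomposition with exactly one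
handle of each index `0, 1, 2` and none of higher index (`HasHandleDecomposition 3 · (fun k => if
k ≤ 2 then 1 else 0)`, the Mazur-type hypothesis of `Mazur1961_double_sphere_four`); the boundary
`∂C = bC.carrier` carries a Morse function with at most `2` critical points of index `1` (Heegaard
genus `≤ 2`, the crux's encoding of thin 3-manifolds); and `S.carrier = C ∪_φ C'`
(`IsBoundaryGluing`). Implied by `SPC4` (`S⁴ = D(W)`, `W` the Akbulut–Mazur cork with
`∂W = Σ(2,5,7)` of Heegaard genus `2`; or `S⁴ = B⁴ ∪ B⁴` with a born cancelling pair in each ball);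
implies the crux (`WidthTwoExists_of`); not known to imply `SPC4` (twisted doubles / cork twists of
`S⁴` along Mazur corks with genus-2 boundary are of this shape and open in general). Why it might
fail: an exotic `Σ` each of whose (1,1,2,1,1)-handle structures — if it has one at all (Kirby
Problem 4.18: 1-handles may be unavoidable) — has middle level of Heegaard genus `≥ 3`.
[cite: AkbulutKirby1979Mazur, doi:10.1307/mmj/1029002261] [cite: Mazur1961, Corollary (2W ≅ S⁴)]
[cite: Matveyev1996, Theorem] [cite: GompfStipsicz1999, §5.1, §9.3] -/
theorem stub_thinMazurSplitting :
    ∀ S : HomotopySphere 4,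
      ∃ (C : Type) (_ : TopologicalSpace C) (_ : T2Space C) (_ : SecondCountableTopology C)
        (_ : ChartedSpace (EuclideanHalfSpace 4) C) (_ : IsManifold (𝓡∂ 4) ∞ C)
        (_ : CompactSpace C) (bC : BoundaryData (𝓡∂ 4) C (𝓡 3))
        (C' : Type) (_ : TopologicalSpace C') (_ : T2Space C') (_ : SecondCountableTopology C')
        (_ : ChartedSpace (EuclideanHalfSpace 4) C') (_ : IsManifold (𝓡∂ 4) ∞ C')
        (_ : CompactSpace C') (bC' : BoundaryData (𝓡∂ 4) C' (𝓡 3))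
        (φ : bC.carrier ≃ₘ⟮𝓡 3, 𝓡 3⟯ bC'.carrier),
        HasHandleDecomposition 3 C (fun k => if k ≤ 2 then 1 else 0) ∧
        HasHandleDecomposition 3 C' (fun k => if k ≤ 2 then 1 else 0) ∧
        (∃ g : bC.carrier → ℝ, IsMorse (𝓡 3) g ∧ (criticalSetOfIndex (𝓡 3) g 1).ncard ≤ 2) ∧
        IsBoundaryGluing bC bC' φ (𝓡 4) S.carrier := by
  sorry

/-- **Stub 2 (KNOWN Morse theory, size L): the half-sweepout of a Mazur-type piece.** A compact
smooth 4-manifold with boundary `C` with a handle decomposition of type (one `0`-, one `1`-, one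
`2`-handle, nothing else) carries a Morse function `f` adapted to `∂C` (`IsMorseAdapted`: `f ≡ 1`
and regular on `∂C`, `f < 1` inside), injective on its critical set, such that every regular level
(`IsRegularLevel (𝓡∂ 4) f t`: an interior level missing the critical set; possibly empty) EITHER
carries a Morse function with at most one critical point of index `1` (the levels `∅`, `S³ = ∂B⁴`,
`∂(B⁴ ∪ h¹) = S¹×S²` or `S¹×~S²`) OR is diffeomorphic to the boundary `bC.carrier` (the levels
above the index-2 critical value: regular interval theorem). Ingredients: rearrangement of critical
values into index order (Smale 1961; Milnor 1965 Thm. 4.8), Milnor 1963 Thms. 3.1–3.2, the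
classification of `B⁴ ∪ h¹`. Why it might fail: it does not (standard); Lean-size L.
[cite: Milnor1963, Thms. 3.1–3.2] [cite: MilnorHCobordism1965, Thm. 4.8] [cite: Kosinski1993, VII §2] -/
theorem stub_mazurHalfSweepout :
    ∀ (C : Type) [TopologicalSpace C] [T2Space C] [SecondCountableTopology C]
      [ChartedSpace (EuclideanHalfSpace 4) C] [IsManifold (𝓡∂ 4) ∞ C] [CompactSpace C]
      (bC : BoundaryData (𝓡∂ 4) C (𝓡 3)),
      HasHandleDecomposition 3 C (fun k => if k ≤ 2 then 1 else 0) →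
        ∃ f : C → ℝ, IsMorseAdapted (𝓡∂ 4) f ∧ Set.InjOn f (criticalSet (𝓡∂ 4) f) ∧
          ∀ (t : ℝ) (h : IsRegularLevel (𝓡∂ 4) f t),
            (∃ g : RegularLevel h → ℝ, IsMorse (𝓡 3) g ∧ (criticalSetOfIndex (𝓡 3) g 1).ncard ≤ 1) ∨
              Nonempty (RegularLevel h ≃ₘ⟮𝓡 3, 𝓡 3⟯ bC.carrier) := by
  sorry

/-- **Stub 3 (KNOWN Morse theory, size L/XL): gluing two thin half-sweepouts along a thin seam.**
Let `C`, `C'` be compact smooth 4-manifolds with boundary with boundary data `bC`, `bC'`,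
`φ : ∂C ≅ ∂C'` a diffeomorphism, and `f`, `f'` Morse functions adapted to the boundaries, injective
on their critical sets, all of whose regular levels either carry a Morse function with `≤ k`
critical points of index `1` or are diffeomorphic to the respective boundary; assume `∂C =
bC.carrier` carries a Morse function with `≤ k` critical points of index `1`. Then every smooth
closed gluing `P = C ∪_φ C'` (`IsBoundaryGluing bC bC' φ (𝓡 4) P`) carries a Morse function,
injective on its critical set, all of whose regular levels carry a Morse function with `≤ k`
critical points of index `1`: `F = f ∪ (2 - f')` after normalising `f`, `f'` to `1 - s` in boundary
collars matched with a tubular neighbourhood of the seam (uniqueness of gluing, Hirsch 1976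
Thm. 8.2.1); its levels are levels of `f`, of `f'`, or copies of `∂C ≅_φ ∂C'`, and Morse data
transport along diffeomorphisms. This is the gluing inequality
`w(C ∪_φ C') ≤ max(w(C,∂C), w(C',∂C'), g(∂C))` for the level-genus width. Why it might fail: it does
not (standard); the Lean cost is the seam smoothing inside an arbitrary `IsBoundaryGluing` witness.
[cite: HirschDT1976, §8.2, Thm. 8.2.1] [cite: Milnor1963, §3] [cite: BrockerJanich1982, §13] -/
theorem stub_glueHalfSweepouts :
    ∀ (k : ℕ) (C C' : Type) [TopologicalSpace C] [T2Space C] [SecondCountableTopology C]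
      [ChartedSpace (EuclideanHalfSpace 4) C] [IsManifold (𝓡∂ 4) ∞ C] [CompactSpace C]
      [TopologicalSpace C'] [T2Space C'] [SecondCountableTopology C']
      [ChartedSpace (EuclideanHalfSpace 4) C'] [IsManifold (𝓡∂ 4) ∞ C'] [CompactSpace C']
      (bC : BoundaryData (𝓡∂ 4) C (𝓡 3)) (bC' : BoundaryData (𝓡∂ 4) C' (𝓡 3))
      (φ : bC.carrier ≃ₘ⟮𝓡 3, 𝓡 3⟯ bC'.carrier) (f : C → ℝ) (f' : C' → ℝ),
      IsMorseAdapted (𝓡∂ 4) f → Set.InjOn f (criticalSet (𝓡∂ 4) f) →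
      (∀ (t : ℝ) (h : IsRegularLevel (𝓡∂ 4) f t),
        (∃ g : RegularLevel h → ℝ, IsMorse (𝓡 3) g ∧ (criticalSetOfIndex (𝓡 3) g 1).ncard ≤ k) ∨
          Nonempty (RegularLevel h ≃ₘ⟮𝓡 3, 𝓡 3⟯ bC.carrier)) →
      IsMorseAdapted (𝓡∂ 4) f' → Set.InjOn f' (criticalSet (𝓡∂ 4) f') →
      (∀ (t : ℝ) (h : IsRegularLevel (𝓡∂ 4) f' t),
        (∃ g : RegularLevel h → ℝ, IsMorse (𝓡 3) g ∧ (criticalSetOfIndex (𝓡 3) g 1).ncard ≤ k) ∨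
          Nonempty (RegularLevel h ≃ₘ⟮𝓡 3, 𝓡 3⟯ bC'.carrier)) →
      (∃ g : bC.carrier → ℝ, IsMorse (𝓡 3) g ∧ (criticalSetOfIndex (𝓡 3) g 1).ncard ≤ k) →
      ∀ (P : Type) [TopologicalSpace P] [T2Space P] [SecondCountableTopology P]
        [ChartedSpace (EuclideanSpace ℝ (Fin 4)) P] [IsManifold (𝓡 4) ∞ P],
        IsBoundaryGluing bC bC' φ (𝓡 4) P →
          ∃ F : P → ℝ, IsMorse (𝓡 4) F ∧ Set.InjOn F (criticalSet (𝓡 4) F) ∧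
            ∀ (t : ℝ) (h : IsRegularLevel (𝓡 4) F t),
              ∃ g : RegularLevel h → ℝ, IsMorse (𝓡 3) g ∧
                (criticalSetOfIndex (𝓡 3) g 1).ncard ≤ k := by
  sorry

/-! ## The composition: the three stubs prove the crux (no `sorry` below this line) -/

/-- **Composition with explicit hypotheses** (`stub₁-sig → stub₂-sig → stub₃-sig → crux statement`,
the crux UNFOLDED so that `WidthTwoExists_of` below is the only by-name conclusion the skeleton
audit sees): split the homotopy sphere as a thin Mazur-type union (stub 1), sweep each piece
(stub 2; `≤ 1 ≤ 2` index-1 points or parallel to the boundary), glue the two half-sweepouts with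
`k = 2` (stub 3). Pure logic. -/
theorem widthTwoExists_of_stubs
    (h₁ : ∀ S : HomotopySphere 4,
      ∃ (C : Type) (_ : TopologicalSpace C) (_ : T2Space C) (_ : SecondCountableTopology C)
        (_ : ChartedSpace (EuclideanHalfSpace 4) C) (_ : IsManifold (𝓡∂ 4) ∞ C)
        (_ : CompactSpace C) (bC : BoundaryData (𝓡∂ 4) C (𝓡 3))
        (C' : Type) (_ : TopologicalSpace C') (_ : T2Space C') (_ : SecondCountableTopology C')
        (_ : ChartedSpace (EuclideanHalfSpace 4) C') (_ : IsManifold (𝓡∂ 4) ∞ C')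
        (_ : CompactSpace C') (bC' : BoundaryData (𝓡∂ 4) C' (𝓡 3))
        (φ : bC.carrier ≃ₘ⟮𝓡 3, 𝓡 3⟯ bC'.carrier),
        HasHandleDecomposition 3 C (fun k => if k ≤ 2 then 1 else 0) ∧
        HasHandleDecomposition 3 C' (fun k => if k ≤ 2 then 1 else 0) ∧
        (∃ g : bC.carrier → ℝ, IsMorse (𝓡 3) g ∧ (criticalSetOfIndex (𝓡 3) g 1).ncard ≤ 2) ∧
        IsBoundaryGluing bC bC' φ (𝓡 4) S.carrier)
    (h₂ : ∀ (C : Type) [TopologicalSpace C] [T2Space C] [SecondCountableTopology C]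
      [ChartedSpace (EuclideanHalfSpace 4) C] [IsManifold (𝓡∂ 4) ∞ C] [CompactSpace C]
      (bC : BoundaryData (𝓡∂ 4) C (𝓡 3)),
      HasHandleDecomposition 3 C (fun k => if k ≤ 2 then 1 else 0) →
        ∃ f : C → ℝ, IsMorseAdapted (𝓡∂ 4) f ∧ Set.InjOn f (criticalSet (𝓡∂ 4) f) ∧
          ∀ (t : ℝ) (h : IsRegularLevel (𝓡∂ 4) f t),
            (∃ g : RegularLevel h → ℝ, IsMorse (𝓡 3) g ∧ (criticalSetOfIndex (𝓡 3) g 1).ncard ≤ 1) ∨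
              Nonempty (RegularLevel h ≃ₘ⟮𝓡 3, 𝓡 3⟯ bC.carrier))
    (h₃ : ∀ (k : ℕ) (C C' : Type) [TopologicalSpace C] [T2Space C] [SecondCountableTopology C]
      [ChartedSpace (EuclideanHalfSpace 4) C] [IsManifold (𝓡∂ 4) ∞ C] [CompactSpace C]
      [TopologicalSpace C'] [T2Space C'] [SecondCountableTopology C']
      [ChartedSpace (EuclideanHalfSpace 4) C'] [IsManifold (𝓡∂ 4) ∞ C'] [CompactSpace C']
      (bC : BoundaryData (𝓡∂ 4) C (𝓡 3)) (bC' : BoundaryData (𝓡∂ 4) C' (𝓡 3))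
      (φ : bC.carrier ≃ₘ⟮𝓡 3, 𝓡 3⟯ bC'.carrier) (f : C → ℝ) (f' : C' → ℝ),
      IsMorseAdapted (𝓡∂ 4) f → Set.InjOn f (criticalSet (𝓡∂ 4) f) →
      (∀ (t : ℝ) (h : IsRegularLevel (𝓡∂ 4) f t),
        (∃ g : RegularLevel h → ℝ, IsMorse (𝓡 3) g ∧ (criticalSetOfIndex (𝓡 3) g 1).ncard ≤ k) ∨
          Nonempty (RegularLevel h ≃ₘ⟮𝓡 3, 𝓡 3⟯ bC.carrier)) →
      IsMorseAdapted (𝓡∂ 4) f' → Set.InjOn f' (criticalSet (𝓡∂ 4) f') →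
      (∀ (t : ℝ) (h : IsRegularLevel (𝓡∂ 4) f' t),
        (∃ g : RegularLevel h → ℝ, IsMorse (𝓡 3) g ∧ (criticalSetOfIndex (𝓡 3) g 1).ncard ≤ k) ∨
          Nonempty (RegularLevel h ≃ₘ⟮𝓡 3, 𝓡 3⟯ bC'.carrier)) →
      (∃ g : bC.carrier → ℝ, IsMorse (𝓡 3) g ∧ (criticalSetOfIndex (𝓡 3) g 1).ncard ≤ k) →
      ∀ (P : Type) [TopologicalSpace P] [T2Space P] [SecondCountableTopology P]
        [ChartedSpace (EuclideanSpace ℝ (Fin 4)) P] [IsManifold (𝓡 4) ∞ P],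
        IsBoundaryGluing bC bC' φ (𝓡 4) P →
          ∃ F : P → ℝ, IsMorse (𝓡 4) F ∧ Set.InjOn F (criticalSet (𝓡 4) F) ∧
            ∀ (t : ℝ) (h : IsRegularLevel (𝓡 4) F t),
              ∃ g : RegularLevel h → ℝ, IsMorse (𝓡 3) g ∧
                (criticalSetOfIndex (𝓡 3) g 1).ncard ≤ k) :
    ∀ S : HomotopySphere 4, ∃ f : S.carrier → ℝ,
      IsMorse (𝓡 4) f ∧ Set.InjOn f (criticalSet (𝓡 4) f) ∧
        ∀ (t : ℝ) (h : IsRegularLevel (𝓡 4) f t), ∃ g : RegularLevel h → ℝ,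
          IsMorse (𝓡 3) g ∧ (criticalSetOfIndex (𝓡 3) g 1).ncard ≤ 2 := by
  intro S
  -- stub 1: the thin Mazur-type splitting `S.carrier = C ∪_φ C'`, `g(∂C) ≤ 2`
  obtain ⟨C, _, _, _, _, _, _, bC, C', _, _, _, _, _, _, bC', φ, hC, hC', hthin, hglue⟩ := h₁ S
  -- stub 2 on each piece: adapted Morse functions with levels of genus ≤ 1 or parallel to `∂`
  obtain ⟨f, hf, hinj, hlev⟩ := h₂ C bC hC
  obtain ⟨f', hf', hinj', hlev'⟩ := h₂ C' bC' hC'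
  have hlev₂ : ∀ (t : ℝ) (h : IsRegularLevel (𝓡∂ 4) f t),
      (∃ g : RegularLevel h → ℝ, IsMorse (𝓡 3) g ∧ (criticalSetOfIndex (𝓡 3) g 1).ncard ≤ 2) ∨
        Nonempty (RegularLevel h ≃ₘ⟮𝓡 3, 𝓡 3⟯ bC.carrier) := fun t h =>
    (hlev t h).imp_left fun ⟨g, hg, hn⟩ => ⟨g, hg, hn.trans one_le_two⟩
  have hlev₂' : ∀ (t : ℝ) (h : IsRegularLevel (𝓡∂ 4) f' t),
      (∃ g : RegularLevel h → ℝ, IsMorse (𝓡 3) g ∧ (criticalSetOfIndex (𝓡 3) g 1).ncard ≤ 2) ∨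
        Nonempty (RegularLevel h ≃ₘ⟮𝓡 3, 𝓡 3⟯ bC'.carrier) := fun t h =>
    (hlev' t h).imp_left fun ⟨g, hg, hn⟩ => ⟨g, hg, hn.trans one_le_two⟩
  -- stub 3 with `k = 2`: glue the two half-sweepouts along the genus-≤2 seam
  exact h₃ 2 C C' bC bC' φ f f' hf hinj hlev₂ hf' hinj' hlev₂' hthin S.carrier hglue

/-- **THE SKELETON THEOREM.** The crux
`Summit.SmoothPoincare4.SmoothPoincare4.Theses.LensThinSweepouts.WidthTwoExists`, concluded BY NAME
from the three DECLARED stubs `stub_thinMazurSplitting`, `stub_mazurHalfSweepout`,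
`stub_glueHalfSweepouts` (the only `sorry`s of the file) through the sorry-free composition
`widthTwoExists_of_stubs`. -/
theorem WidthTwoExists_of : WidthTwoExists :=
  widthTwoExists_of_stubs stub_thinMazurSplitting stub_mazurHalfSweepout stub_glueHalfSweepouts

/-- BC3 letter: `<stub₁-sig> → <stub₂-sig> → <stub₃-sig> → WidthTwoExists` with the crux BY NAME (an
`example`, so that `WidthTwoExists_of` stays the only by-name candidate the skeleton audit sees). -/
example :
    (∀ S : HomotopySphere 4,
      ∃ (C : Type) (_ : TopologicalSpace C) (_ : T2Space C) (_ : SecondCountableTopology C)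
        (_ : ChartedSpace (EuclideanHalfSpace 4) C) (_ : IsManifold (𝓡∂ 4) ∞ C)
        (_ : CompactSpace C) (bC : BoundaryData (𝓡∂ 4) C (𝓡 3))
        (C' : Type) (_ : TopologicalSpace C') (_ : T2Space C') (_ : SecondCountableTopology C')
        (_ : ChartedSpace (EuclideanHalfSpace 4) C') (_ : IsManifold (𝓡∂ 4) ∞ C')
        (_ : CompactSpace C') (bC' : BoundaryData (𝓡∂ 4) C' (𝓡 3))
        (φ : bC.carrier ≃ₘ⟮𝓡 3, 𝓡 3⟯ bC'.carrier),
        HasHandleDecomposition 3 C (fun k => if k ≤ 2 then 1 else 0) ∧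
        HasHandleDecomposition 3 C' (fun k => if k ≤ 2 then 1 else 0) ∧
        (∃ g : bC.carrier → ℝ, IsMorse (𝓡 3) g ∧ (criticalSetOfIndex (𝓡 3) g 1).ncard ≤ 2) ∧
        IsBoundaryGluing bC bC' φ (𝓡 4) S.carrier) →
    (∀ (C : Type) [TopologicalSpace C] [T2Space C] [SecondCountableTopology C]
      [ChartedSpace (EuclideanHalfSpace 4) C] [IsManifold (𝓡∂ 4) ∞ C] [CompactSpace C]
      (bC : BoundaryData (𝓡∂ 4) C (𝓡 3)),
      HasHandleDecomposition 3 C (fun k => if k ≤ 2 then 1 else 0) →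
        ∃ f : C → ℝ, IsMorseAdapted (𝓡∂ 4) f ∧ Set.InjOn f (criticalSet (𝓡∂ 4) f) ∧
          ∀ (t : ℝ) (h : IsRegularLevel (𝓡∂ 4) f t),
            (∃ g : RegularLevel h → ℝ, IsMorse (𝓡 3) g ∧ (criticalSetOfIndex (𝓡 3) g 1).ncard ≤ 1) ∨
              Nonempty (RegularLevel h ≃ₘ⟮𝓡 3, 𝓡 3⟯ bC.carrier)) →
    (∀ (k : ℕ) (C C' : Type) [TopologicalSpace C] [T2Space C] [SecondCountableTopology C]
      [ChartedSpace (EuclideanHalfSpace 4) C] [IsManifold (𝓡∂ 4) ∞ C] [CompactSpace C]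
      [TopologicalSpace C'] [T2Space C'] [SecondCountableTopology C']
      [ChartedSpace (EuclideanHalfSpace 4) C'] [IsManifold (𝓡∂ 4) ∞ C'] [CompactSpace C']
      (bC : BoundaryData (𝓡∂ 4) C (𝓡 3)) (bC' : BoundaryData (𝓡∂ 4) C' (𝓡 3))
      (φ : bC.carrier ≃ₘ⟮𝓡 3, 𝓡 3⟯ bC'.carrier) (f : C → ℝ) (f' : C' → ℝ),
      IsMorseAdapted (𝓡∂ 4) f → Set.InjOn f (criticalSet (𝓡∂ 4) f) →
      (∀ (t : ℝ) (h : IsRegularLevel (𝓡∂ 4) f t),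
        (∃ g : RegularLevel h → ℝ, IsMorse (𝓡 3) g ∧ (criticalSetOfIndex (𝓡 3) g 1).ncard ≤ k) ∨
          Nonempty (RegularLevel h ≃ₘ⟮𝓡 3, 𝓡 3⟯ bC.carrier)) →
      IsMorseAdapted (𝓡∂ 4) f' → Set.InjOn f' (criticalSet (𝓡∂ 4) f') →
      (∀ (t : ℝ) (h : IsRegularLevel (𝓡∂ 4) f' t),
        (∃ g : RegularLevel h → ℝ, IsMorse (𝓡 3) g ∧ (criticalSetOfIndex (𝓡 3) g 1).ncard ≤ k) ∨
          Nonempty (RegularLevel h ≃ₘ⟮𝓡 3, 𝓡 3⟯ bC'.carrier)) →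
      (∃ g : bC.carrier → ℝ, IsMorse (𝓡 3) g ∧ (criticalSetOfIndex (𝓡 3) g 1).ncard ≤ k) →
      ∀ (P : Type) [TopologicalSpace P] [T2Space P] [SecondCountableTopology P]
        [ChartedSpace (EuclideanSpace ℝ (Fin 4)) P] [IsManifold (𝓡 4) ∞ P],
        IsBoundaryGluing bC bC' φ (𝓡 4) P →
          ∃ F : P → ℝ, IsMorse (𝓡 4) F ∧ Set.InjOn F (criticalSet (𝓡 4) F) ∧
            ∀ (t : ℝ) (h : IsRegularLevel (𝓡 4) F t),
              ∃ g : RegularLevel h → ℝ, IsMorse (𝓡 3) g ∧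
                (criticalSetOfIndex (𝓡 3) g 1).ncard ≤ k) →
    WidthTwoExists :=
  widthTwoExists_of_stubs

end Summit.SmoothPoincare4.SmoothPoincare4.Cruxes.WidthTwoExists.Birth

end
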